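import Mathlib.AlgebraicGeometry.Morphisms.Affine
import Mathlib.AlgebraicGeometry.Pullbacks
import Mathlib.Algebra.Category.Ring.Constructions
import Literature.AlgebraicGeometry.Morphisms.SectionConormalChart
import HarnessLib

/-!
# The affine charts of a fibre `Y = X ×_{Spec R} Spec T`: `Γ(Y, p⁻¹W) ≅ T ⊗_R Γ(X, W)` as a ring isomorphism

Topic `Literature/AlgebraicGeometry/Morphisms`, namespace `Literature.AlgebraicGeometry.Morphisms`.  DEFINITIONS (a ring
isomorphism and its structure map) and THEOREMS; no named fact (net debt 0).  Sequel of `Morphisms/SectionConormalChart`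
(`ChartRing f W = Γ(X, W)` as an `R`-algebra) and companion of `Morphisms/AffineBaseChangeChart` (which proves the pushout
property for the CHOSEN `pullback f g`; here an arbitrary cartesian square `IsPullback p t f (Spec T → Spec R)` and the
resulting explicit isomorphism with the tensor product).  Brick G3b-1′ of cell `hodgecm-mathlib`, row II-2β.

THE PRINT.  Görtz–Wedhorn, *Algebraic Geometry I*, Prop. 4.20 / Thm. 4.18 (Stacks 01JO): `Spec A ×_{Spec R} Spec B =
Spec (A ⊗_R B)`; for `Y = X ×_{Spec R} Spec T → X` and an affine `W ⊆ X`, `p⁻¹W = W ×_R T` is affine with coordinate ring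
`Γ(X, W) ⊗_R T`, the structure maps being `p^♯` and `t^♯`.

WHAT IS HERE (`hP : IsPullback p t f (Spec.map (R → T))`, `hW : IsAffineOpen W`):
* `isAffineHom_of_isPullback`, `isAffineOpen_preimage_of_isPullback` — `p` is affine, `p⁻¹W` is affine;
* `isPushout_app_of_isPullback` — `IsPushout (f^♯ : Γ(Spec R) → Γ(X, W)) ((Spec T → Spec R)^♯) (p^♯) (t^♯)`;
* `fibreConst p t W : T → Γ(Y, p⁻¹W)` (`a ↦ t^♯(a)|_{p⁻¹W}`), `isPushout_algebraMap_of_isPullback` (the `R`-algebra form);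
* **`fibreChartIso f p t hP hW : T ⊗[R] ChartRing f W ≃+* Γ(Y, p⁻¹W)`**, `fibreChartIso_tmul`:
  `a ⊗ s ↦ t^♯(a) · p^♯(s)`.

## References
* [GortzWedhorn2020] U. Görtz, T. Wedhorn, *Algebraic Geometry I*, 2nd ed. (2020), Thm. 4.18, Prop. 4.20, Prop. 12.3.
* [StacksProject] The Stacks Project, Tags 01JO, 01JS.
-/

noncomputable section

-- `TopCat.Presheaf` is not reducible (as in Mathlib's `AlgebraicGeometry/Modules` and `Morphisms/AffineBaseChangeChart`).
set_option backward.isDefEq.respectTransparency false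

open CategoryTheory CategoryTheory.Limits AlgebraicGeometry TopologicalSpace Opposite TensorProduct

universe u

namespace Literature.AlgebraicGeometry.Morphisms

open ChartRing

variable {R : Type u} [CommRing R] {X : Scheme.{u}} (f : X ⟶ Spec (.of R))

namespace ChartRing

/-- The identity cast as a ring isomorphism `Γ(X, W) ≃+* ChartRing f W`. [cite: GortzWedhorn2020, §(3.2)] -/
def mkRingEquiv (W : X.Opens) : Γ(X, W) ≃+* ChartRing f W := RingEquiv.refl _

/-- `mkRingEquiv` is `mk`. [cite: GortzWedhorn2020, §(3.2)] -/
@[simp] theorem mkRingEquiv_apply (W : X.Opens) (x : Γ(X, W)) : mkRingEquiv f W x = mk f W x := rfl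

end ChartRing

/-! ## §4 Charts of a fibre: `Γ(Y, p⁻¹W) = T ⊗_R Γ(X, W)` -/

section Fibre

variable {T : Type u} [CommRing T] [Algebra R T] {Y : Scheme.{u}} (p : Y ⟶ X) (t : Y ⟶ Spec (.of T))
  (hP : IsPullback p t f (Spec.map (CommRingCat.ofHom (algebraMap R T)))) {W : X.Opens} (hW : IsAffineOpen W)

include hP in
/-- The fibre projection `p : Y = X ×_R T → X` is an affine morphism (a base change of `Spec T → Spec R`).
[cite: GortzWedhorn2020, Prop. 12.3 (3)] [cite: StacksProject, Tag 01JS] -/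
theorem isAffineHom_of_isPullback : IsAffineHom p :=
  MorphismProperty.of_isPullback (P := @IsAffineHom) hP.flip inferInstance

include hP hW in
/-- **`p⁻¹ W` is affine** for an affine `W ⊆ X`. [cite: StacksProject, Tag 01JS] -/
theorem isAffineOpen_preimage_of_isPullback : IsAffineOpen (p ⁻¹ᵁ W) :=
  haveI := isAffineHom_of_isPullback f p t hP
  hW.preimage p

include hP in
/-- The chart square `p⁻¹W → W → Spec R ← Spec T` is cartesian (pasting the restriction square onto the fibre square).
[cite: StacksProject, Tag 01JO] [cite: GortzWedhorn2020, Prop. 4.20] -/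
theorem isPullback_chart_of_isPullback :
    IsPullback (p ∣_ W) ((p ⁻¹ᵁ W).ι ≫ t) (W.ι ≫ f) (Spec.map (CommRingCat.ofHom (algebraMap R T))) :=
  (isPullback_morphismRestrict p W).paste_vert hP

include hP hW in
/-- `Γ(p⁻¹W, ⊤) = Γ(W, ⊤) ⊗_{Γ(Spec R)} Γ(Spec T)` (restricted-scheme form; Mathlib `isPushout_appTop_of_isPullback`).
[cite: StacksProject, Tag 01JO] -/
theorem isPushout_appTop_of_isPullback :
    IsPushout (W.ι ≫ f).appTop (Spec.map (CommRingCat.ofHom (algebraMap R T))).appTop (p ∣_ W).appTop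
      ((p ⁻¹ᵁ W).ι ≫ t).appTop :=
  haveI : IsAffine (W : Scheme.{u}) := hW
  AlgebraicGeometry.isPushout_appTop_of_isPullback (isPullback_chart_of_isPullback f p t hP)

include hP hW in
/-- **`Γ(Y, p⁻¹W) = Γ(X, W) ⊗_{Γ(Spec R)} Γ(Spec T)`** with the structure maps `p^♯ : Γ(X, W) → Γ(Y, p⁻¹W)` and
`t^♯ : Γ(Spec T) → Γ(Y, p⁻¹W)` — the proof of `Morphisms/AffineBaseChangeChart.isPushout_chart` for an arbitrary cartesian
square instead of the chosen `pullback f g`. [cite: StacksProject, Tag 01JO] [cite: GortzWedhorn2020, Prop. 4.20] -/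
theorem isPushout_app_of_isPullback :
    IsPushout (f.appLE ⊤ W le_top) (Spec.map (CommRingCat.ofHom (algebraMap R T))).appTop (p.app W)
      (t.appLE ⊤ (p ⁻¹ᵁ W) le_top) := by
  -- adapted from `Literature.AlgebraicGeometry.Morphisms.isPushout_chart`
  refine (isPushout_appTop_of_isPullback f p t hP hW).of_iso (Iso.refl _) W.topIso (Iso.refl _) (p ⁻¹ᵁ W).topIso
    ?_ ?_ ?_ ?_
  · rw [Iso.refl_hom, Category.id_comp, Scheme.Hom.comp_appTop, Scheme.Opens.ι_appTop, Scheme.Opens.topIso_hom,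
      Category.assoc]
    change f.appLE ⊤ (W.ι ''ᵁ ⊤) le_top ≫ _ = _
    rw [Scheme.Hom.appLE_map]
  · simp only [Iso.refl_hom, Category.id_comp, Category.comp_id]
  · rw [Scheme.Opens.topIso_hom, Scheme.Opens.topIso_hom, morphismRestrict_appTop, Category.assoc, ← Functor.map_comp,
      Scheme.Hom.naturality]
    exact congrArg (fun k => p.app (W.ι ''ᵁ ⊤) ≫ Y.presheaf.map k) (Quiver.Hom.unop_inj (Subsingleton.elim _ _))
  · rw [Iso.refl_hom, Category.id_comp, Scheme.Hom.comp_appTop, Scheme.Opens.ι_appTop, Scheme.Opens.topIso_hom,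
      Category.assoc]
    change t.appLE ⊤ ((p ⁻¹ᵁ W).ι ''ᵁ ⊤) le_top ≫ _ = _
    rw [Scheme.Hom.appLE_map]

/-- The structure map `T → Γ(Y, p⁻¹W)` of the fibre chart: `a ↦ t^♯(a)|_{p⁻¹W}`. [cite: GortzWedhorn2020, Prop. 4.20] -/
def fibreConst (W : X.Opens) : CommRingCat.of T ⟶ Γ(Y, p ⁻¹ᵁ W) :=
  (Scheme.ΓSpecIso (.of T)).inv ≫ t.appLE ⊤ (p ⁻¹ᵁ W) le_top

/-- Unfolding of `fibreConst`. [cite: GortzWedhorn2020, Prop. 4.20] -/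
theorem fibreConst_apply (W : X.Opens) (a : T) :
    fibreConst p t W a = t.appLE ⊤ (p ⁻¹ᵁ W) le_top ((Scheme.ΓSpecIso (.of T)).inv a) :=
  rfl

include hP hW in
/-- **The fibre chart square in `R`-algebra form**: `IsPushout (R → T) (R → Γ(X, W)) (T → Γ(Y, p⁻¹W)) (p^♯)`.
[cite: StacksProject, Tag 01JO] [cite: GortzWedhorn2020, Prop. 4.20] -/
theorem isPushout_algebraMap_of_isPullback :
    IsPushout (CommRingCat.ofHom (algebraMap R T)) (CommRingCat.ofHom (algebraMap R (ChartRing f W)))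
      (fibreConst p t W) (CommRingCat.ofHom ((p.app W).hom.comp (val : ChartRing f W →+* Γ(X, W)))) := by
  refine (isPushout_app_of_isPullback f p t hP hW).flip.of_iso (Scheme.ΓSpecIso (.of R)) (Scheme.ΓSpecIso (.of T))
    (ChartRing.mkRingEquiv f W).toCommRingCatIso (Iso.refl _) ?_ ?_ ?_ ?_
  · exact Scheme.ΓSpecIso_naturality (CommRingCat.ofHom (algebraMap R T))
  · ext x
    change mk f W (f.appLE ⊤ W le_top x) =
      algebraMap R (ChartRing f W) ((Scheme.ΓSpecIso (.of R)).hom x)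
    apply val_injective
    rw [val_mk, val_algebraMap, ← CommRingCat.comp_apply (Scheme.ΓSpecIso (.of R)).hom, Iso.hom_inv_id]
    rfl
  · rw [Iso.refl_hom, Category.comp_id, fibreConst, Iso.hom_inv_id_assoc]
  · rfl

/-- **The fibre chart: `T ⊗_R Γ(X, W) ≅ Γ(Y, p⁻¹W)`** as rings, for a cartesian square `Y = X ×_{Spec R} Spec T` and an
affine `W ⊆ X` (Görtz–Wedhorn I, Prop. 4.20: `Spec A ×_{Spec R} Spec B = Spec (A ⊗_R B)`, glued along `W`).
[cite: GortzWedhorn2020, Prop. 4.20 and Thm. 4.18] [cite: StacksProject, Tag 01JO] -/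
def fibreChartIso : T ⊗[R] ChartRing f W ≃+* Γ(Y, p ⁻¹ᵁ W) :=
  ((CommRingCat.isPushout_tensorProduct R T (ChartRing f W)).isoIsPushout _ _
      (isPushout_algebraMap_of_isPullback f p t hP hW)).commRingCatIsoToRingEquiv

/-- `fibreChartIso (a ⊗ 1) = t^♯(a)`. [cite: GortzWedhorn2020, Prop. 4.20] -/
theorem fibreChartIso_tmul_one (a : T) :
    fibreChartIso f p t hP hW (a ⊗ₜ[R] 1) = fibreConst p t W a := by
  have := congrArg (fun φ => φ.hom a) ((CommRingCat.isPushout_tensorProduct R T (ChartRing f W)).inl_isoIsPushout_hom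
    _ _ (isPushout_algebraMap_of_isPullback f p t hP hW))
  simp only [CommRingCat.hom_comp, RingHom.comp_apply, CommRingCat.hom_ofHom] at this
  exact this

/-- `fibreChartIso (1 ⊗ s) = p^♯(s)`. [cite: GortzWedhorn2020, Prop. 4.20] -/
theorem fibreChartIso_one_tmul (s : ChartRing f W) :
    fibreChartIso f p t hP hW (1 ⊗ₜ[R] s) = p.app W (val s) := by
  have := congrArg (fun φ => φ.hom s) ((CommRingCat.isPushout_tensorProduct R T (ChartRing f W)).inr_isoIsPushout_hom
    _ _ (isPushout_algebraMap_of_isPullback f p t hP hW))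
  simp only [CommRingCat.hom_comp, RingHom.comp_apply, CommRingCat.hom_ofHom] at this
  exact this

/-- **`fibreChartIso (a ⊗ s) = t^♯(a) · p^♯(s)`.** [cite: GortzWedhorn2020, Prop. 4.20] -/
theorem fibreChartIso_tmul (a : T) (s : ChartRing f W) :
    fibreChartIso f p t hP hW (a ⊗ₜ[R] s) = fibreConst p t W a * p.app W (val s) := by
  rw [← mul_one a, ← one_mul s, ← Algebra.TensorProduct.tmul_mul_tmul, map_mul, mul_one, one_mul,
    fibreChartIso_tmul_one, fibreChartIso_one_tmul]

end Fibre

end Literature.AlgebraicGeometry.Morphisms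

end
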